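import Literature.NumberTheory.EllipticCurves.XCubeAddTSqThreeDescent
import Mathlib.Tactic.NormNum.Prime
import HarnessLib

/-!
# `y² = x³ + 2465²` and `y² = x³ − 27·2465²` over `ℚ`: RANK EXACTLY `3` and `Ш[3^∞] = 0` by complete `√−3`-descent
# (the first `3`-descent door at rank `3` in the tree)

Topic `NumberTheory/EllipticCurves`. Instance `t = 2465 = 5 · 17 · 29` (three odd primes `≡ 2 (mod 3)`) of the class-wide
`√−3`-descent of `XCubeAddTSqThreeDescent.lean` (`MordellT`): the Selmer box over `K3 = ℚ(ζ₃)` is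
`⟨[2], [5], [17], [29]⟩` (`81` classes), so `rank ≤ 3` (`MordellT.mordellWeilRank_le_card_primeFactors`); and the box is
FILLED by the descent values `δ(X, Y) = Y + 27t` of four RATIONAL points of `A' : Y² = X³ + (27·2465)²`
(found by a seconds-long search; `A' ≅ A_{2465} : y² = x³ + 2465²` by `(X, Y) = (9x, 27y)`):

* `(4446, 303831)`: `δ = 370386 = 2 · 57³` — class `[2]`;
* `(2835, −164970)`: `δ = −98415 = −5 · 27³` — class `[5]`;
* `(−30821/25, −6319342/125)`: `δ = 2000033/125 = 17 · (49/5)³` — class `[17]`;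
* `(−2871/4, 509733/8)`: `δ = 1042173/8 = 29 · (33/2)³` — class `[29]`.

Hence (`MordellT.door_at_three_of_generators`, `MordellT.mordellWeilRank_eq_card_primeFactors`), UNCONDITIONALLY:

* `Mordell2465.mordellWeilRank_curve`: **`rank (y² = x³ + 2465²)(ℚ) = 3`** and `rank (y² = x³ − 27·2465²)(ℚ) = 3`;
* `Mordell2465.shaCorank_three` / `primaryComponent_sha_three`: **`Ш(E/ℚ)[3^∞] = 0`, `corank_{ℤ₃} Ш(E/ℚ)[3^∞] = 0`** for
  `E : y² = x³ − 27·2465² = x³ − 164058075`;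
* `Mordell2465.selmerCorank_three`: `corank_{ℤ₃} Sel_{3^∞}(E/ℚ) = 3 = rank E(ℚ)`;
* `Mordell2465.door_at_three_rank_three`: the conjunction — an elliptic curve over `ℚ` of Mordell–Weil rank `3` whose
  `3`-primary Tate–Shafarevich group vanishes, certified by descent at the prime `3` alone (no `L`-function, no Iwasawa
  theory; compare the rank-`2` door `XCubeSub81675ShaThree.lean` and the `2`-descent ladder through rank `7` at `p = 2`).

## References

* [Jeong2019RankExactlyTwoII] K. Jeong, Proc. Japan Acad. Ser. A 95 (2019) 53–57, §3 (the method, `t = pq`).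
* [CohenPazuki2009] H. Cohen, F. Pazuki, Acta Arith. 140 (2009) 369–404, Thm. 2.1, §5.
* [SilvermanAEC2009] J. H. Silverman, *AEC* 2nd ed., Thm. X.4.2, Remark X.4.7, Exercise 10.9.
* [Greenberg1999LNM] R. Greenberg, LNM 1716 (1999), §1.
-/

noncomputable section

open scoped Classical WithZero

open WeierstrassCurve IsDedekindDomain IsDedekindDomain.HeightOneSpectrum NumberField
open WithZero (log exp)
open Literature.NumberTheory.NumberFields Literature.NumberTheory.NumberFields.K3

namespace Literature.NumberTheory.EllipticCurves

namespace Mordell2465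

/-! ## §1 The parameter `t = 2465 = 5 · 17 · 29` -/

/-- `2465` is odd (the hypothesis `t` odd of the `√−3`-descent box). [cite: Jeong2019RankExactlyTwoII, §3] -/
theorem hodd : ¬ 2 ∣ (2465 : ℕ) := by norm_num

/-- `2465 = 5 · 17 · 29`: its prime factors. [cite: Jeong2019RankExactlyTwoII, §3] -/
theorem primeFactors_eq : (2465 : ℕ).primeFactors = {5, 17, 29} := by
  rw [show (2465 : ℕ) = 5 * (17 * 29) by norm_num, Nat.primeFactors_mul (by norm_num) (by norm_num),
    Nat.primeFactors_mul (by norm_num) (by norm_num), (by norm_num : Nat.Prime 5).primeFactors,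
    (by norm_num : Nat.Prime 17).primeFactors, (by norm_num : Nat.Prime 29).primeFactors]
  rfl

/-- `ω(2465) = 3` (the rank bound `ω(t)`). [cite: Jeong2019RankExactlyTwoII, Prop. 3.5] -/
theorem card_primeFactors : (2465 : ℕ).primeFactors.card = 3 := by
  rw [primeFactors_eq]; rfl

/-- Every prime factor of `2465` is `≡ 2 (mod 3)` (`5, 17, 29` are inert in `ℚ(ζ₃)`). [cite: IrelandRosen1990, Prop. 9.1.4] -/
theorem hinert : ∀ q ∈ (2465 : ℕ).primeFactors, q % 3 = 2 := by
  intro q hq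
  rw [primeFactors_eq] at hq
  simp only [Finset.mem_insert, Finset.mem_singleton] at hq
  rcases hq with rfl | rfl | rfl <;> norm_num

/-- The primes dividing `2t = 4930` are `2, 5, 17, 29` (the generators of the Selmer box). [cite: Jeong2019RankExactlyTwoII, Lemma 3.3] -/
theorem primeFactors_two_mul_eq : (2 * 2465 : ℕ).primeFactors = {2, 5, 17, 29} := by
  rw [Nat.primeFactors_mul (by norm_num) (by norm_num), Nat.Prime.primeFactors Nat.prime_two, primeFactors_eq]
  rfl

/-! ## §2 Four rational points of `A' : Y² = X³ + 66555²` whose descent values are `[2], [5], [17], [29]` -/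

/-- The codomain of the `μ₃`-descent: `A' = E_{81·7395²} : Y² = X³ + 66555²` is non-degenerate. [cite: Jeong2019RankExactlyTwoII, §3] -/
theorem hA' : (81 : K3) * ((3 * 2465 : ℕ) : K3) ^ 2 ≠ 0 := by norm_num

/-- **The box generators are descent values of rational points**: for every prime `q ∣ 2 · 2465`, `[q] = [δ(P)]` for an
explicit `P ∈ A'(ℚ) ⊂ A'(K3)` — `(4446, 303831) ↦ 2·57³`, `(2835, −164970) ↦ −5·27³`,
`(−30821/25, −6319342/125) ↦ 17·(49/5)³`, `(−2871/4, 509733/8) ↦ 29·(33/2)³`. [cite: Jeong2019RankExactlyTwoII, §3] -/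
theorem cubeClass_mem_range : ∀ q ∈ (2 * 2465 : ℕ).primeFactors, MordellDescent.cubeClass ((q : ℕ) : K3) ∈
    Set.range (fun P : (mordellCurve (81 * ((3 * 2465 : ℕ) : K3) ^ 2)).toAffine.Point =>
      MordellDescent.cubeClass (MordellDescent.phiDescent ((3 * 2465 : ℕ) : K3) P)) := by
  have hP2 : (mordellCurve (81 * ((3 * 2465 : ℕ) : K3) ^ 2)).toAffine.Nonsingular 4446 303831 :=
    nonsingular_mordellCurve_of_equation hA' ((mordellCurve_equation_iff _ _ _).mpr (by norm_num))
  have hP5 : (mordellCurve (81 * ((3 * 2465 : ℕ) : K3) ^ 2)).toAffine.Nonsingular 2835 (-164970) :=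
    nonsingular_mordellCurve_of_equation hA' ((mordellCurve_equation_iff _ _ _).mpr (by norm_num))
  have hP17 : (mordellCurve (81 * ((3 * 2465 : ℕ) : K3) ^ 2)).toAffine.Nonsingular (-30821 / 25) (-6319342 / 125) :=
    nonsingular_mordellCurve_of_equation hA' ((mordellCurve_equation_iff _ _ _).mpr (by norm_num))
  have hP29 : (mordellCurve (81 * ((3 * 2465 : ℕ) : K3) ^ 2)).toAffine.Nonsingular (-2871 / 4) (509733 / 8) :=
    nonsingular_mordellCurve_of_equation hA' ((mordellCurve_equation_iff _ _ _).mpr (by norm_num))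
  have hδ2 : MordellDescent.phiDescent ((3 * 2465 : ℕ) : K3) (Affine.Point.some _ _ hP2) = 2 * 57 ^ 3 := by
    rw [MordellDescent.phiDescent_some, if_neg (by norm_num)]; norm_num
  have hδ5 : MordellDescent.phiDescent ((3 * 2465 : ℕ) : K3) (Affine.Point.some _ _ hP5) = -5 * 27 ^ 3 := by
    rw [MordellDescent.phiDescent_some, if_neg (by norm_num)]; norm_num
  have hδ17 : MordellDescent.phiDescent ((3 * 2465 : ℕ) : K3) (Affine.Point.some _ _ hP17) = 17 * (49 / 5) ^ 3 := by
    rw [MordellDescent.phiDescent_some, if_neg (by norm_num)]; norm_num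
  have hδ29 : MordellDescent.phiDescent ((3 * 2465 : ℕ) : K3) (Affine.Point.some _ _ hP29) = 29 * (33 / 2) ^ 3 := by
    rw [MordellDescent.phiDescent_some, if_neg (by norm_num)]; norm_num
  intro q hq
  rw [primeFactors_two_mul_eq] at hq
  simp only [Finset.mem_insert, Finset.mem_singleton] at hq
  rcases hq with rfl | rfl | rfl | rfl
  · refine ⟨Affine.Point.some _ _ hP2, ?_⟩
    change MordellDescent.cubeClass (MordellDescent.phiDescent ((3 * 2465 : ℕ) : K3) (Affine.Point.some _ _ hP2)) = _
    rw [hδ2, MordellDescent.cubeClass_mul_pow_three (by norm_num) (by norm_num)]; norm_num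
  · refine ⟨Affine.Point.some _ _ hP5, ?_⟩
    change MordellDescent.cubeClass (MordellDescent.phiDescent ((3 * 2465 : ℕ) : K3) (Affine.Point.some _ _ hP5)) = _
    rw [hδ5, MordellDescent.cubeClass_mul_pow_three (by norm_num) (by norm_num), show (-5 : K3) = -(5 : K3) by norm_num,
      MordellDescent.cubeClass_neg]; norm_num
  · refine ⟨Affine.Point.some _ _ hP17, ?_⟩
    change MordellDescent.cubeClass (MordellDescent.phiDescent ((3 * 2465 : ℕ) : K3) (Affine.Point.some _ _ hP17)) = _
    rw [hδ17, MordellDescent.cubeClass_mul_pow_three (by norm_num) (by norm_num)]; norm_num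
  · refine ⟨Affine.Point.some _ _ hP29, ?_⟩
    change MordellDescent.cubeClass (MordellDescent.phiDescent ((3 * 2465 : ℕ) : K3) (Affine.Point.some _ _ hP29)) = _
    rw [hδ29, MordellDescent.cubeClass_mul_pow_three (by norm_num) (by norm_num)]; norm_num

/-! ## §3 Rank `3` and `Ш[3^∞] = 0` -/

/-- **`rank (y² = x³ + 2465²)(ℚ) = 3` and `rank (y² = x³ − 27·2465²)(ℚ) = 3` exactly** (Selmer box `⟨[2],[5],[17],[29]⟩`
filled by rational points; `#δ(A'(K3)) = 3^{rank+1} = 81`). [cite: Jeong2019RankExactlyTwoII, Prop. 3.5] -/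
theorem mordellWeilRank_curve :
    (mordellCurve (((2465 : ℕ) : ℚ) ^ 2)).mordellWeilRank = 3 ∧
      (mordellCurve (-27 * ((2465 : ℕ) : ℚ) ^ 2)).mordellWeilRank = 3 := by
  have h := MordellT.mordellWeilRank_eq_card_primeFactors (t := 2465) hodd hinert cubeClass_mem_range
  rwa [card_primeFactors] at h

/-- **`corank_{ℤ₃} Ш(E/ℚ)[3^∞] = 0`** for `E : y² = x³ − 27·2465²` — the door at `3` (`t_3(E) = 0`) at rank `3`.
[cite: Greenberg1999LNM, §1] -/
theorem shaCorank_three : (mordellCurve (-27 * ((2465 : ℕ) : ℚ) ^ 2)).shaCorank 3 = 0 :=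
  (MordellT.shaCorank_three_eq_zero (t := 2465) hodd hinert cubeClass_mem_range).1

/-- **`Ш(E/ℚ)[3^∞] = 0`** for `E : y² = x³ − 27·2465²`. [cite: CohenPazuki2009, Thm. 2.1] -/
theorem primaryComponent_sha_three :
    AddCommGroup.primaryComponent (mordellCurve (-27 * ((2465 : ℕ) : ℚ) ^ 2)).sha 3 = ⊥ :=
  (MordellT.shaCorank_three_eq_zero (t := 2465) hodd hinert cubeClass_mem_range).2

/-- `Ш(E/ℚ)[3] = 0` elementwise for `E : y² = x³ − 27·2465²`. [cite: CohenPazuki2009, Thm. 2.1] -/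
theorem forall_mem_sha_three_nsmul_eq_zero :
    ∀ c₀ ∈ (mordellCurve (-27 * ((2465 : ℕ) : ℚ) ^ 2)).sha, 3 • c₀ = 0 → c₀ = 0 :=
  MordellT.forall_mem_sha_three_nsmul_eq_zero_rat (t := 2465) hodd hinert cubeClass_mem_range

/-- **`corank_{ℤ₃} Sel_{3^∞}(E/ℚ) = 3`** for `E : y² = x³ − 27·2465²` (`= rank + t_3 = 3 + 0`). [cite: Greenberg1999LNM, §1] -/
theorem selmerCorank_three : (mordellCurve (-27 * ((2465 : ℕ) : ℚ) ^ 2)).selmerCorank 3 = 3 := by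
  have h := (MordellT.door_at_three_of_generators (t := 2465) hodd hinert cubeClass_mem_range).2.2.2
  rwa [card_primeFactors] at h

/-- `E : y² = x³ − 27·2465² = x³ − 164058075` is an elliptic curve (`Δ = −432·(27t²)² ≠ 0`). [cite: SilvermanAEC2009, III.1] -/
theorem isElliptic_curve : (mordellCurve (-27 * ((2465 : ℕ) : ℚ) ^ 2)).IsElliptic :=
  isElliptic_mordellCurve (by norm_num)

/-- The model: `mordellCurve (−27·2465²) = ⟨0, 0, 0, 0, −164058075⟩`. [cite: SilvermanAEC2009, III.1] -/
theorem curve_eq : mordellCurve (-27 * ((2465 : ℕ) : ℚ) ^ 2) = ⟨0, 0, 0, 0, -164058075⟩ := by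
  rw [mordellCurve]; norm_num

/-- **The door at `3` at rank `3`**: `E : y² = x³ − 164058075` has `rank E(ℚ) = 3`, `corank_{ℤ₃} Ш(E/ℚ)[3^∞] = 0`,
`Ш(E/ℚ)[3^∞] = 0` and `corank_{ℤ₃} Sel_{3^∞}(E/ℚ) = 3` — unconditionally, by `√−3`-descent over `ℚ(ζ₃)`.
[cite: Jeong2019RankExactlyTwoII, Prop. 3.5] [cite: Greenberg1999LNM, §1] -/
theorem door_at_three_rank_three :
    (mordellCurve (-27 * ((2465 : ℕ) : ℚ) ^ 2)).mordellWeilRank = 3 ∧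
      (mordellCurve (-27 * ((2465 : ℕ) : ℚ) ^ 2)).shaCorank 3 = 0 ∧
      AddCommGroup.primaryComponent (mordellCurve (-27 * ((2465 : ℕ) : ℚ) ^ 2)).sha 3 = ⊥ ∧
      (mordellCurve (-27 * ((2465 : ℕ) : ℚ) ^ 2)).selmerCorank 3 = 3 :=
  ⟨mordellWeilRank_curve.2, shaCorank_three, primaryComponent_sha_three, selmerCorank_three⟩

end Mordell2465

end Literature.NumberTheory.EllipticCurves
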